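import Literature.Analysis.FluidPDE.TypeIAncientMild
import Literature.Analysis.FluidPDE.OseenZoomCovariance
import Literature.Analysis.FluidPDE.SelfSimilarProofs
import Summits.NavierStokesRegularity.NavierStokesRegularity.Theorems.ClockStretchingLawSteadySliceLiouvilleAnalytic
import HarnessLib

/-!
# Route ClockStretchingLaw — crux `ClockCeiling`, line `registered`: the parabolic zoom of the
# Type-I class

Helper file for the lead's stub `stub_zoomCompactness` of the reshaped skeleton of crux
`ClockCeiling` (item stmt-NavierStokesRegularity-10570). For a field `u : ℝ → ℝ³ → ℝ³` and
`c > 0` the parabolic zoom is the tree's `nsRescale c u`, `(t, x) ↦ c • u (c² t) (c • x)`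
(Leray 1934 §20; KNSS 2009 §1 (1.2)). This file proves that the five clauses of the route's
Type-I class — joint smoothness on `(-∞,0) × ℝ³`, divergence-free slices, the KNSS-mild Oseen
identity, the Type-I bound `‖u(t,x)‖ ≤ C/√(-t)`, and the scale-invariant local energies
`A, E ≤ C` — are invariant under the zoom with the SAME constant `C`, and computes the zoomed
clock and translation modes: `∂ₜ(nsRescale c u)(t,x) = c³ ∂ₜu(c²t, cx)`,
`∇(nsRescale c u)(t)(x) = c² ∇u(c²t)(cx)`, whence the frame form of the skeleton satisfies
`frame_{nsRescale c u}(t; c₀, b) = frame_u(c²t; c₀, b)`.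

## References

* J. Leray, Acta Math. 63 (1934), §20 (the scaling symmetry).
* G. Koch, N. Nadirashvili, G. Seregin, V. Šverák, Acta Math. 203 (2009) = arXiv:0709.3599,
  §1 (1.2), (1.4) (scale invariance of the Type I bound), Lemma 6.1.
-/

set_option linter.dupNamespace false

noncomputable section

open Literature.Analysis.FluidPDE MeasureTheory Set Function Filter Topology Metric
open Literature.Analysis.UnboundedOperators (heatExtension)
open scoped ENNReal NNReal Pointwise

namespace Summit.NavierStokesRegularity.NavierStokesRegularity.Theorems

section Zoom

variable {C c : ℝ} {u : ℝ → (EuclideanSpace ℝ (Fin 3)) → (EuclideanSpace ℝ (Fin 3))}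

/-! ### The linear substitution `(t, x) ↦ (c² t, c x)` -/

/-- The parabolic dilation `(t, x) ↦ (c²t, cx)` maps the open slab `(-∞,0) × ℝ³` into itself
(`c ≠ 0`). -/
theorem zoom_mapsTo (hc : 0 < c) :
    MapsTo (fun p : ℝ × (EuclideanSpace ℝ (Fin 3)) => (c ^ 2 * p.1, c • p.2))
      (Iio (0 : ℝ) ×ˢ (univ : Set (EuclideanSpace ℝ (Fin 3))))
      (Iio (0 : ℝ) ×ˢ (univ : Set (EuclideanSpace ℝ (Fin 3)))) := by
  intro p hp
  obtain ⟨hp1, -⟩ := mem_prod.1 hp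
  exact mk_mem_prod (mul_neg_of_pos_of_neg (pow_pos hc 2) (mem_Iio.1 hp1)) (mem_univ _)

/-- **Joint smoothness is zoom invariant**: if `uncurry u` is `C^∞` on `(-∞,0) × ℝ³` then so is
`uncurry (nsRescale c u)`, `c > 0`. -/
theorem zoom_contDiffOn (hsm : ContDiffOn ℝ (⊤ : ℕ∞) (uncurry u) (Iio 0 ×ˢ univ)) (hc : 0 < c) :
    ContDiffOn ℝ (⊤ : ℕ∞) (uncurry (nsRescale c u)) (Iio 0 ×ˢ univ) := by
  have hlin : ContDiff ℝ (⊤ : ℕ∞)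
      (fun p : ℝ × (EuclideanSpace ℝ (Fin 3)) => (c ^ 2 * p.1, c • p.2)) := by fun_prop
  have h := (hsm.comp hlin.contDiffOn (zoom_mapsTo hc)).const_smul c
  refine h.congr fun p _ => ?_
  simp [nsRescale, uncurry]

/-- The slices of the zoom: `nsRescale c u t = fun x => c • u (c²t) (c • x)`. -/
theorem nsRescale_slice_eq (c : ℝ) (u : ℝ → (EuclideanSpace ℝ (Fin 3)) → (EuclideanSpace ℝ (Fin 3))) (t : ℝ) :
    nsRescale c u t = fun x => c • u (c ^ 2 * t) (c • x) := rfl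

/-- **The gradient of a zoomed slice**: `D(nsRescale c u (t))(x) = c² • Du(c²t)(cx)`
(chain rule for the homothety and linearity; needs differentiability of the slice at `cx`). -/
theorem fderiv_zoom_slice {t : ℝ} {x : EuclideanSpace ℝ (Fin 3)}
    (hd : DifferentiableAt ℝ (u (c ^ 2 * t)) (c • x)) :
    fderiv ℝ (nsRescale c u t) x = (c ^ 2) • fderiv ℝ (u (c ^ 2 * t)) (c • x) := by
  rw [nsRescale_slice_eq]
  have h1 : fderiv ℝ (fun y => u (c ^ 2 * t) (c • y)) x = c • fderiv ℝ (u (c ^ 2 * t)) (c • x) :=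
    fderiv_comp_smul c
  have hd' : DifferentiableAt ℝ (fun y => u (c ^ 2 * t) (c • y)) x :=
    hd.comp x (differentiableAt_id.const_smul c)
  have h2 : (fun y => c • u (c ^ 2 * t) (c • y)) = c • (fun y => u (c ^ 2 * t) (c • y)) := rfl
  rw [h2, fderiv_const_smul hd', h1, smul_smul, sq]

/-- **Divergence-free slices are zoom invariant** (`div (c u(c²t)(c ·)) = c² (div u(c²t))(c ·)`). -/
theorem zoom_isDivFree (hdiv : ∀ t < 0, VectorCalculus.IsDivFree (u t))
    (hdiff : ∀ t < 0, Differentiable ℝ (u t)) (hc : 0 < c) :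
    ∀ t < 0, VectorCalculus.IsDivFree (nsRescale c u t) := by
  intro t ht x
  have hct : c ^ 2 * t < 0 := mul_neg_of_pos_of_neg (by positivity) ht
  have h0 := hdiv (c ^ 2 * t) hct (c • x)
  simp only [VectorCalculus.divergence] at h0 ⊢
  rw [fderiv_zoom_slice ((hdiff _ hct) _), ContinuousLinearMap.toLinearMap_smul, map_smul, h0,
    smul_zero]

/-- **The KNSS-mild Oseen identity is zoom invariant** (KNSS 2009 §1 (1.2): the tree's
`oseen_zoom` with the identity isometry). -/
theorem zoom_mild
    (hmildO : ∀ s t : ℝ, s < t → t < 0 → ∀ x,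
      u t x = heatExtension (u s) (t - s) x - oseenDuhamel 1 s u u t x)
    (hc : 0 < c) :
    ∀ s t : ℝ, s < t → t < 0 → ∀ x,
      nsRescale c u t x = heatExtension (nsRescale c u s) (t - s) x -
        oseenDuhamel 1 s (nsRescale c u) (nsRescale c u) t x := by
  intro s t hst ht y
  have hc2 : 0 < c ^ 2 := by positivity
  have hst' : c ^ 2 * s < c ^ 2 * t := mul_lt_mul_of_pos_left hst hc2
  have hct : c ^ 2 * t < 0 := mul_neg_of_pos_of_neg hc2 ht
  have key := oseen_zoom hc (LinearIsometryEquiv.refl ℝ (EuclideanSpace ℝ (Fin 3))) (f := u) hst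
    (fun X => by
      have h := hmildO (c ^ 2 * s) (c ^ 2 * t) hst' hct X
      exact h) y
  have e1 : ∀ z, (LinearIsometryEquiv.refl ℝ (EuclideanSpace ℝ (Fin 3))).symm z = z := fun z => rfl
  have e2 : ∀ z, (LinearIsometryEquiv.refl ℝ (EuclideanSpace ℝ (Fin 3))) z = z := fun z => rfl
  simp only [e1, e2] at key
  exact key

/-- **The zoom of a Type-I ancient mild field is a Type-I ancient mild field** with the same
constant (KNSS 2009 §1: all four clauses are scale invariant). -/
theorem zoom_isTypeIAncientMild (h : IsTypeIAncientMild C u) (hc : 0 < c) :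
    IsTypeIAncientMild C (nsRescale c u) := by
  refine ⟨zoom_contDiffOn h.contDiffOn hc, zoom_isDivFree (fun t ht => h.isDivFree ht)
    (fun t ht => (h.contDiff_slice ht).differentiable (by simp)) hc, fun s t hst ht x => ?_,
    h.hasTypeITimeDecay.nsRescale hc⟩
  rw [heatFlow_of_pos _ (sub_pos.2 hst)]
  exact zoom_mild (fun s t hst ht x => h.mild_eq_heatExtension hst ht x) hc s t hst ht x

/-! ### The local energies under the zoom -/

/-- Space substitution on balls: `∫_{B(x₀,r)} g(c x) dx = (c³)⁻¹ ∫_{B(c x₀, c r)} g(y) dy`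
(`c > 0`, any integrand; Haar change of variables). -/
theorem setIntegral_ball_comp_smul {F : Type*} [NormedAddCommGroup F] [NormedSpace ℝ F]
    (g : (EuclideanSpace ℝ (Fin 3)) → F) (hc : 0 < c) (x₀ : EuclideanSpace ℝ (Fin 3)) (r : ℝ) :
    ∫ x in ball x₀ r, g (c • x) = (c ^ 3)⁻¹ • ∫ y in ball (c • x₀) (c * r), g y := by
  rw [Measure.setIntegral_comp_smul_of_pos volume g (ball x₀ r) hc, finrank_euclideanSpace_fin,
    smul_ball hc.ne' x₀ r, Real.norm_of_nonneg hc.le]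

/-- Time substitution on intervals: `∫_{(a,b)} G(c t) dt = c⁻¹ ∫_{(ca, cb)} G(s) ds` (`c > 0`,
any integrand). -/
theorem setIntegral_Ioo_comp_mul_left' {F : Type*} [NormedAddCommGroup F] [NormedSpace ℝ F]
    (G : ℝ → F) (hc : 0 < c) {a b : ℝ} (hab : a ≤ b) :
    ∫ t in Ioo a b, G (c * t) = c⁻¹ • ∫ s in Ioo (c * a) (c * b), G s := by
  rw [← integral_Ioc_eq_integral_Ioo, ← intervalIntegral.integral_of_le hab,
    intervalIntegral.integral_comp_mul_left G hc.ne',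
    intervalIntegral.integral_of_le (mul_le_mul_of_nonneg_left hab hc.le),
    integral_Ioc_eq_integral_Ioo]

/-- **The scaled kinetic energy `A` is zoom invariant**:
`r⁻¹ ∫_{B(x₀,r)} ‖nsRescale c u (t)‖² = (cr)⁻¹ ∫_{B(cx₀,cr)} ‖u(c²t)‖²` (`c, r > 0`). -/
theorem zoom_energyA (hc : 0 < c) {r : ℝ} (hr : 0 < r) (x₀ : EuclideanSpace ℝ (Fin 3)) (t : ℝ) :
    r⁻¹ * ∫ x in ball x₀ r, ‖nsRescale c u t x‖ ^ 2 =
      (c * r)⁻¹ * ∫ y in ball (c • x₀) (c * r), ‖u (c ^ 2 * t) y‖ ^ 2 := by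
  have h1 : (fun x => ‖nsRescale c u t x‖ ^ 2) = fun x => c ^ 2 * ‖u (c ^ 2 * t) (c • x)‖ ^ 2 := by
    funext x
    rw [nsRescale_apply, norm_smul, Real.norm_of_nonneg hc.le, mul_pow]
  have h2 : ∫ x in ball x₀ r, ‖u (c ^ 2 * t) (c • x)‖ ^ 2 =
      (c ^ 3)⁻¹ * ∫ y in ball (c • x₀) (c * r), ‖u (c ^ 2 * t) y‖ ^ 2 := by
    simpa only [smul_eq_mul] using setIntegral_ball_comp_smul (fun y => ‖u (c ^ 2 * t) y‖ ^ 2) hc x₀ r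
  rw [h1, integral_const_mul, h2]
  field_simp

/-- **The scaled dissipation `E` is zoom invariant**:
`r⁻¹ ∫_{(t₀-r², t₀)} ∫_{B(x₀,r)} ‖D(nsRescale c u)(t)‖² = (cr)⁻¹ ∫_{(c²t₀-(cr)², c²t₀)} ∫_{B(cx₀,cr)} ‖Du(s)‖²`
(`c, r > 0`; slices differentiable at the relevant times). -/
theorem zoom_energyE (hdiff : ∀ t < 0, Differentiable ℝ (u t)) (hc : 0 < c) {r t₀ : ℝ}
    (hr : 0 < r) (ht₀ : t₀ ≤ 0) (x₀ : EuclideanSpace ℝ (Fin 3)) :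
    r⁻¹ * ∫ t in Ioo (t₀ - r ^ 2) t₀, ∫ x in ball x₀ r, ‖fderiv ℝ (nsRescale c u t) x‖ ^ 2 =
      (c * r)⁻¹ * ∫ s in Ioo (c ^ 2 * t₀ - (c * r) ^ 2) (c ^ 2 * t₀),
        ∫ y in ball (c • x₀) (c * r), ‖fderiv ℝ (u s) y‖ ^ 2 := by
  have hc2 : 0 < c ^ 2 := by positivity
  -- the inner integrals agree at every `t < t₀ ≤ 0`
  have hin : ∀ t ∈ Ioo (t₀ - r ^ 2) t₀,
      ∫ x in ball x₀ r, ‖fderiv ℝ (nsRescale c u t) x‖ ^ 2 =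
        c * ∫ y in ball (c • x₀) (c * r), ‖fderiv ℝ (u (c ^ 2 * t)) y‖ ^ 2 := by
    intro t ht
    have hct : c ^ 2 * t < 0 := mul_neg_of_pos_of_neg hc2 (ht.2.trans_le ht₀)
    have h1 : (fun x => ‖fderiv ℝ (nsRescale c u t) x‖ ^ 2) =
        fun x => c ^ 4 * ‖fderiv ℝ (u (c ^ 2 * t)) (c • x)‖ ^ 2 := by
      funext x
      rw [fderiv_zoom_slice ((hdiff _ hct) _), norm_smul, Real.norm_of_nonneg hc2.le, mul_pow]
      ring
    have h2 : ∫ x in ball x₀ r, ‖fderiv ℝ (u (c ^ 2 * t)) (c • x)‖ ^ 2 =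
        (c ^ 3)⁻¹ * ∫ y in ball (c • x₀) (c * r), ‖fderiv ℝ (u (c ^ 2 * t)) y‖ ^ 2 := by
      simpa only [smul_eq_mul] using
        setIntegral_ball_comp_smul (fun y => ‖fderiv ℝ (u (c ^ 2 * t)) y‖ ^ 2) hc x₀ r
    rw [h1, integral_const_mul, h2]
    field_simp
  have h3 : ∫ t in Ioo (t₀ - r ^ 2) t₀, ∫ y in ball (c • x₀) (c * r), ‖fderiv ℝ (u (c ^ 2 * t)) y‖ ^ 2 =
      (c ^ 2)⁻¹ * ∫ s in Ioo (c ^ 2 * (t₀ - r ^ 2)) (c ^ 2 * t₀),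
        ∫ y in ball (c • x₀) (c * r), ‖fderiv ℝ (u s) y‖ ^ 2 := by
    simpa only [smul_eq_mul] using setIntegral_Ioo_comp_mul_left'
      (fun s => ∫ y in ball (c • x₀) (c * r), ‖fderiv ℝ (u s) y‖ ^ 2) hc2
      (show t₀ - r ^ 2 ≤ t₀ by nlinarith)
  rw [setIntegral_congr_fun measurableSet_Ioo hin, integral_const_mul, h3,
    show c ^ 2 * (t₀ - r ^ 2) = c ^ 2 * t₀ - (c * r) ^ 2 by ring]
  field_simp

/-- **The local-energy clause of the class is zoom invariant** (same constant): if
`A(x₀,t₀,r), E(x₀,t₀,r) ≤ C` for all parabolic cylinders below `t = 0`, then the same holds for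
`nsRescale c u`, `c > 0`. -/
theorem zoom_localEnergy (hdiff : ∀ t < 0, Differentiable ℝ (u t)) (hc : 0 < c)
    (hLE : ∀ (x₀ : EuclideanSpace ℝ (Fin 3)) (t₀ r : ℝ), t₀ ≤ 0 → 0 < r →
      (∀ t, t₀ - r ^ 2 < t → t < t₀ → r⁻¹ * ∫ x in ball x₀ r, ‖u t x‖ ^ 2 ≤ C) ∧
        r⁻¹ * ∫ t in Ioo (t₀ - r ^ 2) t₀, ∫ x in ball x₀ r, ‖fderiv ℝ (u t) x‖ ^ 2 ≤ C) :
    ∀ (x₀ : EuclideanSpace ℝ (Fin 3)) (t₀ r : ℝ), t₀ ≤ 0 → 0 < r →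
      (∀ t, t₀ - r ^ 2 < t → t < t₀ → r⁻¹ * ∫ x in ball x₀ r, ‖nsRescale c u t x‖ ^ 2 ≤ C) ∧
        r⁻¹ * ∫ t in Ioo (t₀ - r ^ 2) t₀, ∫ x in ball x₀ r,
          ‖fderiv ℝ (nsRescale c u t) x‖ ^ 2 ≤ C := by
  intro x₀ t₀ r ht₀ hr
  have hc2 : 0 < c ^ 2 := by positivity
  have hct₀ : c ^ 2 * t₀ ≤ 0 := mul_nonpos_of_nonneg_of_nonpos hc2.le ht₀
  obtain ⟨hA, hE⟩ := hLE (c • x₀) (c ^ 2 * t₀) (c * r) hct₀ (mul_pos hc hr)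
  refine ⟨fun t h1 h2 => ?_, ?_⟩
  · rw [zoom_energyA hc hr]
    refine hA (c ^ 2 * t) ?_ (mul_lt_mul_of_pos_left h2 hc2)
    have : c ^ 2 * (t₀ - r ^ 2) < c ^ 2 * t := mul_lt_mul_of_pos_left h1 hc2
    nlinarith
  · rw [zoom_energyE hdiff hc hr ht₀]
    exact hE

/-! ### The zoomed clock and translation modes -/

/-- **The time derivative of the zoom**: `∂ₜ(nsRescale c u)(t, x) = c³ ∂ₜu(c²t, cx)` (chain
rule; needs differentiability of the time curve of `u` at `c²t`). -/
theorem timeDeriv_zoom {t : ℝ} {x : EuclideanSpace ℝ (Fin 3)}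
    (hd : DifferentiableAt ℝ (fun s => u s (c • x)) (c ^ 2 * t)) :
    timeDeriv (nsRescale c u) t x = (c ^ 3) • timeDeriv u (c ^ 2 * t) (c • x) := by
  simp only [timeDeriv_apply]
  have h0 : (fun s => nsRescale c u s x) = c • (fun s => (fun τ => u τ (c • x)) (c ^ 2 * s)) := by
    funext s; rfl
  rw [h0]
  have hd' : DifferentiableAt ℝ (fun s => (fun τ => u τ (c • x)) (c ^ 2 * s)) t :=
    hd.comp t (differentiableAt_id.const_mul _)
  rw [deriv_const_smul c hd', deriv_comp_mul_left (c ^ 2) (fun τ => u τ (c • x)) t, smul_smul]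
  ring_nf

/-- `√(-(c²t)) = c √(-t)` for `c ≥ 0`. -/
theorem sqrt_neg_sq_mul (hc : 0 ≤ c) (t : ℝ) : Real.sqrt (-(c ^ 2 * t)) = c * Real.sqrt (-t) := by
  rw [show -(c ^ 2 * t) = c ^ 2 * -t by ring, Real.sqrt_mul (sq_nonneg c), Real.sqrt_sq hc]

/-- **The frame form is zoom invariant**: for `c > 0`, `t < 0` and any direction `(c₀, b)`,
`√(-t) ∫ ‖(c₀√(-t)) • ∂ₜ(nsRescale c u)(t,x) + D(nsRescale c u)(t)(x) b‖² e^{-‖x‖²/(4(-t))} dx`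
equals the same expression for `u` at time `c²t` (substitute `y = cx`; the modes scale by `c³`
and `c²`, the weight is invariant, `dx = c⁻³dy`, `√(-t) = c⁻¹√(-c²t)`). Needs differentiability
of the time curves and of the slice of `u` at time `c²t` (true in the class). -/
theorem frame_zoom (hc : 0 < c) {t : ℝ}
    (hdt : ∀ y, DifferentiableAt ℝ (fun s => u s y) (c ^ 2 * t))
    (hdx : Differentiable ℝ (u (c ^ 2 * t))) (c₀ : ℝ) (b : EuclideanSpace ℝ (Fin 3)) :
    Real.sqrt (-t) * ∫ x, ‖(c₀ * Real.sqrt (-t)) • timeDeriv (nsRescale c u) t x +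
        fderiv ℝ (nsRescale c u t) x b‖ ^ 2 * Real.exp (-(‖x‖ ^ 2) / (4 * (-t))) =
      Real.sqrt (-(c ^ 2 * t)) * ∫ y, ‖(c₀ * Real.sqrt (-(c ^ 2 * t))) •
        timeDeriv u (c ^ 2 * t) y + fderiv ℝ (u (c ^ 2 * t)) y b‖ ^ 2 *
          Real.exp (-(‖y‖ ^ 2) / (4 * (-(c ^ 2 * t)))) := by
  set s : ℝ := c ^ 2 * t with hs
  set G : (EuclideanSpace ℝ (Fin 3)) → ℝ := fun y => ‖(c₀ * Real.sqrt (-s)) • timeDeriv u s y +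
    fderiv ℝ (u s) y b‖ ^ 2 * Real.exp (-(‖y‖ ^ 2) / (4 * (-s))) with hG
  have hsqrt : Real.sqrt (-s) = c * Real.sqrt (-t) := sqrt_neg_sq_mul hc.le t
  -- the integrand of the zoom is `c⁴ G(c x)`
  have hpt : ∀ x, ‖(c₀ * Real.sqrt (-t)) • timeDeriv (nsRescale c u) t x +
      fderiv ℝ (nsRescale c u t) x b‖ ^ 2 * Real.exp (-(‖x‖ ^ 2) / (4 * (-t))) = c ^ 4 * G (c • x) := by
    intro x
    have hw : Real.exp (-(‖c • x‖ ^ 2) / (4 * (-s))) = Real.exp (-(‖x‖ ^ 2) / (4 * (-t))) := by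
      congr 1
      rw [norm_smul, Real.norm_of_nonneg hc.le, mul_pow, hs]
      have ht0 : c ^ 2 ≠ 0 := by positivity
      field_simp
    rw [hG]
    simp only []
    rw [hw, timeDeriv_zoom (hdt (c • x)), fderiv_zoom_slice (hdx (c • x)), smul_smul,
      FunLike.coe_smul, Pi.smul_apply, hsqrt]
    have e1 : (c₀ * Real.sqrt (-t) * c ^ 3) • timeDeriv u (c ^ 2 * t) (c • x) +
        (c ^ 2) • fderiv ℝ (u (c ^ 2 * t)) (c • x) b =
        (c ^ 2) • ((c₀ * (c * Real.sqrt (-t))) • timeDeriv u s (c • x) + fderiv ℝ (u s) (c • x) b) := by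
      rw [smul_add, smul_smul, hs]
      congr 1
      ring_nf
    rw [e1, norm_smul, Real.norm_of_nonneg (by positivity : (0 : ℝ) ≤ c ^ 2)]
    ring
  have hI : ∫ x, ‖(c₀ * Real.sqrt (-t)) • timeDeriv (nsRescale c u) t x +
      fderiv ℝ (nsRescale c u t) x b‖ ^ 2 * Real.exp (-(‖x‖ ^ 2) / (4 * (-t))) = c * ∫ y, G y := by
    rw [show (fun x => ‖(c₀ * Real.sqrt (-t)) • timeDeriv (nsRescale c u) t x +
        fderiv ℝ (nsRescale c u t) x b‖ ^ 2 * Real.exp (-(‖x‖ ^ 2) / (4 * (-t)))) =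
        fun x => c ^ 4 * G (c • x) from funext hpt, integral_const_mul,
      Measure.integral_comp_smul_of_nonneg volume G c (hR := hc.le), finrank_euclideanSpace_fin,
      smul_eq_mul]
    field_simp
  rw [hI, hsqrt]
  ring


/-! ### The class is zoom invariant (registered sub-goal of `stub_zoomCompactness`) -/

/-- **The route's Type-I class is invariant under the parabolic zoom, with the same constant**:
if `u` satisfies the five clauses (joint smoothness, divergence-free slices, the KNSS-mild Oseen
identity written out through `UnboundedOperators.heatKernel`, `HasTypeITimeDecay C u`, local
energies `A, E ≤ C`) then so does `nsRescale c u = (t,x) ↦ c • u (c²t) (c • x)` for every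
`c > 0` (KNSS 2009 §1 (1.2), (1.4)). -/
theorem zoomClass_nsRescale :
    ∀ (C c : ℝ) (u : ℝ → EuclideanSpace ℝ (Fin 3) → EuclideanSpace ℝ (Fin 3)), 0 < c → (ContDiffOn ℝ (⊤ : ℕ∞) (Function.uncurry u) (Set.Iio 0 ×ˢ Set.univ) ∧ (∀ t < 0, Literature.Analysis.FluidPDE.VectorCalculus.IsDivFree (u t)) ∧ (∀ s t : ℝ, s < t → t < 0 → ∀ x, u t x = Literature.Analysis.FluidPDE.heatFlow (u s) (t - s) x - ∫ τ in Set.Ioo s t, ∫ y, ((-(inner ℝ (x - y) (u τ y) / (2 * (t - τ)) * Literature.Analysis.UnboundedOperators.heatKernel (t - τ) (x - y))) • u τ y + (∫ σ in Set.Ioi (t - τ), Literature.Analysis.UnboundedOperators.heatKernel σ (x - y) / (4 * σ ^ 2)) • (inner ℝ (x - y) (u τ y) • u τ y + inner ℝ (u τ y) (u τ y) • (x - y) + inner ℝ (x - y) (u τ y) • u τ y) - ((∫ σ in Set.Ioi (t - τ), Literature.Analysis.UnboundedOperators.heatKernel σ (x - y) / (8 * σ ^ 3)) * (inner ℝ (x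 - y) (u τ y) * inner ℝ (x - y) (u τ y))) • (x - y))) ∧ Literature.Analysis.FluidPDE.HasTypeITimeDecay C u ∧ (∀ (x₀ : EuclideanSpace ℝ (Fin 3)) (t₀ r : ℝ), t₀ ≤ 0 → 0 < r → (∀ t, t₀ - r ^ 2 < t → t < t₀ → r⁻¹ * ∫ x in Metric.ball x₀ r, ‖u t x‖ ^ 2 ≤ C) ∧ r⁻¹ * ∫ t in Set.Ioo (t₀ - r ^ 2) t₀, ∫ x in Metric.ball x₀ r, ‖fderiv ℝ (u t) x‖ ^ 2 ≤ C)) → (ContDiffOn ℝ (⊤ : ℕ∞) (Function.uncurry (Literature.Analysis.FluidPDE.nsRescale c u)) (Set.Iio 0 ×ˢ Set.univ) ∧ (∀ t < 0, Literature.Analysis.FluidPDE.VectorCalculus.IsDivFree ((Literature.Analysis.FluidPDE.nsRescale c u) t)) ∧ (∀ s t : ℝ, s < t → t < 0 → ∀ x, (Literature.Analysis.FluidPDE.nsRescale c u) t x = Literature.Analysis.FluidPDE.heatFlow ((Literature.Analysis.FluidPDE.nsRescale c u) s) (t - s) x - ∫ τ in Set.Ioo s t, ∫ y, ((-(inner ℝ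 (x - y) ((Literature.Analysis.FluidPDE.nsRescale c u) τ y) / (2 * (t - τ)) * Literature.Analysis.UnboundedOperators.heatKernel (t - τ) (x - y))) • (Literature.Analysis.FluidPDE.nsRescale c u) τ y + (∫ σ in Set.Ioi (t - τ), Literature.Analysis.UnboundedOperators.heatKernel σ (x - y) / (4 * σ ^ 2)) • (inner ℝ (x - y) ((Literature.Analysis.FluidPDE.nsRescale c u) τ y) • (Literature.Analysis.FluidPDE.nsRescale c u) τ y + inner ℝ ((Literature.Analysis.FluidPDE.nsRescale c u) τ y) ((Literature.Analysis.FluidPDE.nsRescale c u) τ y) • (x - y) + inner ℝ (x - y) ((Literature.Analysis.FluidPDE.nsRescale c u) τ y) • (Literature.Analysis.FluidPDE.nsRescale c u) τ y) - ((∫ σ in Set.Ioi (t - τ), Literature.Analysis.UnboundedOperators.heatKernel σ (x - y) / (8 * σ ^ 3)) * (inner ℝ (x - y) ((Literature.Analysis.FluidPDE.nsRescale c u) τ y) * inner ℝ (x - y) ((Literature.Analysis.FluidPDE.nsRescale c u) τ y))) • (x - y))) ∧ Literature.Analysis.FluidPDE.HasTypeITimeDecay C (Literature.Analysis.FluidPDE.nsRescale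 c u) ∧ (∀ (x₀ : EuclideanSpace ℝ (Fin 3)) (t₀ r : ℝ), t₀ ≤ 0 → 0 < r → (∀ t, t₀ - r ^ 2 < t → t < t₀ → r⁻¹ * ∫ x in Metric.ball x₀ r, ‖(Literature.Analysis.FluidPDE.nsRescale c u) t x‖ ^ 2 ≤ C) ∧ r⁻¹ * ∫ t in Set.Ioo (t₀ - r ^ 2) t₀, ∫ x in Metric.ball x₀ r, ‖fderiv ℝ ((Literature.Analysis.FluidPDE.nsRescale c u) t) x‖ ^ 2 ≤ C)) := by
  intro C c u hc hu
  obtain ⟨h1, h2, h3, h4, h5⟩ := hu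
  have hTI : IsTypeIAncientMild C u := isTypeIAncientMild_iff.2 ⟨h1, h2, h3, h4⟩
  have hz : IsTypeIAncientMild C (nsRescale c u) := zoom_isTypeIAncientMild hTI hc
  have hz' := isTypeIAncientMild_iff.1 hz
  refine ⟨hz'.1, hz'.2.1, hz'.2.2.1, hz'.2.2.2, ?_⟩
  exact zoom_localEnergy (fun t ht => (hTI.contDiff_slice ht).differentiable (by simp)) hc h5

end Zoom

end Summit.NavierStokesRegularity.NavierStokesRegularity.Theorems

end
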